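import Literature.MathematicalPhysics.QuantumLattice.FockRelabel
import Summits.HubbardSuperconductivity.HubbardSuperconductivity.Theorems.FunctionFieldCertificateWindowInfraredBoundReductions
import Literature.MathematicalPhysics.QuantumLattice.FermionOperatorsProofs
import Literature.MathematicalPhysics.QuantumLattice.HubbardWave0LiebProofs
import HarnessLib

/-!
# Crux `MesoscopicPairOrder` (stmt-HubbardSuperconductivity-7331) — refutation of the card's BOX ORDER, file 1 of 2:
# local pairs on the filled lattice and the two extreme sectors

Supports item `stmt-HubbardSuperconductivity-7331` (route `FunctionFieldCertificate`, pole-free crux; open physics,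
not settled here). Helper file (independent of the transfer files) for
`Theorems/FunctionFieldCertificateMesoscopicPairOrderBoxOrderRefutation.lean`,
which refutes the residue `BoxOrder` of the crux-idea card `window-stationarity-box-transfer` (mean-density box
order) with the phase-separated witness `ρ = p|univ⟩⟨univ| + (1-p)|∅⟩⟨∅|`. This file supplies the facts about the
two components (no definition is introduced; `|univ⟩ = Pi.single univ 1` is the filled lattice, `|∅⟩ = vacuum`):

* §1 `annihilation_mul_annihilation_mulVec_full_apply_eq_zero`, `localPair_mulVec_full_apply_eq_zero` — `P_y|univ⟩`
  is supported on the basis vectors `(univ ∖ {(y+e, σ̄)}) ∖ {(y, σ)}`; `star_localPair_full_dotProduct_eq_zero` —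
  ORTHOGONALITY `⟨P_x univ, P_y univ⟩ = 0` unless `x = y + e`, `e ∈ {0, ±e₁, ±e₂}`; `re_dotProduct_le_half`;
  `card_filter_near_le_five`; `re_star_block_full_le` — `Re⟨B'_u univ, B'_u univ⟩ ≤ 160 R'²` for `R' ≤ L`
  (`B'_u = Σ_{w ∈ [0,R')²} P_{u+w}`, `‖P_x ψ‖² ≤ 32‖ψ‖²`); `localPair_mulVec_vacuum` — `P_x |∅⟩ = 0`;
  `fullLatticeBlockBound` — registered form of `re_star_block_full_le`.
* §2 `isNParticle_vacuum'`, `isNParticle_full`, `eq_smul_vacuum_of_isNParticle_zero`,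
  `eq_smul_full_of_isNParticle_card` (the sectors `0` and `|Orb|` are one-dimensional),
  `hubbardTorus_commute_totalNumberOp`, `comm_mulVec_eq_zero_of_eigen` (`(HQ - QH)φ = 0` for a common eigenvector),
  `numberOp_mulVec_full` (`n_{xσ}|univ⟩ = |univ⟩`), `expect_relabel_translate_full`, `expect_relabel_translate_vacuum`
  (translation invariance of both components).

Sources: Bratteli–Robinson II §5.2.2 (CAR algebra in the occupation basis); Tasaki (2020) §9.2. All folklore.
-/

noncomputable section

-- the summit namespace `Summit.HubbardSuperconductivity.HubbardSuperconductivity.…` repeats the problem name by design (D-0017)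
set_option linter.dupNamespace false

namespace Summit.HubbardSuperconductivity.HubbardSuperconductivity.Theorems.FunctionFieldCertificate

open Matrix Finset Filter
open Literature.Probability.LatticeModels Literature.MathematicalPhysics.QuantumLattice
open Summit.HubbardSuperconductivity.HubbardSuperconductivity.Theses.FunctionFieldCertificate
open scoped ComplexOrder

/-- (Local) the order-derived `DecidableEq` on the orbitals of the torus, so that occupation-basis terms written
here (`Pi.single`, `Finset.erase`) match the Literature lemmas, which are stated over `[LinearOrder ι]`. -/
local instance (priority := high) instDecidableEqOrbTorus (L : ℕ) : DecidableEq (Orb (FermionTorus 2 L)) :=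
  LinearOrder.toDecidableEq

/-! ### §1 Local pairs on the filled lattice -/

section Full

variable {L : ℕ} [NeZero L]

omit [NeZero L] in
/-- Two annihilations on the filled lattice give (a sign times) ONE basis vector:
`(c_a c_b |univ⟩)(t) = 0` unless `t = (univ ∖ {b}) ∖ {a}`. [folklore] -/
theorem annihilation_mul_annihilation_mulVec_full_apply_eq_zero (a b : Orb (FermionTorus 2 L))
    {t : Finset (Orb (FermionTorus 2 L))} (ht : t ≠ (Finset.univ.erase b).erase a) :
    ((annihilation a * annihilation b) *ᵥ Pi.single (Finset.univ : Finset (Orb (FermionTorus 2 L))) (1 : ℂ)) t = 0 := by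
  rw [← mulVec_mulVec, annihilation_mulVec_single, if_pos (Finset.mem_univ b), mulVec_smul,
    annihilation_mulVec_single]
  by_cases hab : a ∈ Finset.univ.erase b
  · rw [if_pos hab, Pi.smul_apply, Pi.smul_apply, Pi.single_eq_of_ne ht, smul_zero, smul_zero]
  · rw [if_neg hab, smul_zero, Pi.zero_apply]

/-- The local pair field applied to the filled lattice is supported on the basis vectors
`(univ ∖ {(y+e, σ̄)}) ∖ {(y, σ)}`, `e ∈ {0, ±e₁, ±e₂}`. [folklore] -/
theorem localPair_mulVec_full_apply_eq_zero (g : Site 2 → ℝ) (y : TorusSite 2 L)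
    {t : Finset (Orb (FermionTorus 2 L))}
    (ht : ∀ e ∈ insert (0 : Site 2) unitSteps,
      t ≠ (Finset.univ.erase (orb (FermionTorus.ofTorusSite (y + Torus.proj L e)) 1)).erase
          (orb (FermionTorus.ofTorusSite y) 0) ∧
      t ≠ (Finset.univ.erase (orb (FermionTorus.ofTorusSite (y + Torus.proj L e)) 0)).erase
          (orb (FermionTorus.ofTorusSite y) 1)) :
    (localPair g L y *ᵥ Pi.single (Finset.univ : Finset (Orb (FermionTorus 2 L))) (1 : ℂ)) t = 0 := by
  unfold localPair
  rw [Matrix.sum_mulVec, Finset.sum_apply]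
  refine Finset.sum_eq_zero fun e he => ?_
  rw [smul_mulVec, sub_mulVec, Pi.smul_apply, Pi.sub_apply,
    annihilation_mul_annihilation_mulVec_full_apply_eq_zero _ _ (ht e he).1,
    annihilation_mul_annihilation_mulVec_full_apply_eq_zero _ _ (ht e he).2, sub_zero, smul_zero]

/-- `FermionTorus.ofTorusSite` is injective. [folklore] -/
theorem ofTorusSite_injective' {x y : TorusSite 2 L} (h : FermionTorus.ofTorusSite x = FermionTorus.ofTorusSite y) :
    x = y := by
  rw [← FermionTorus.toTorusSite_ofTorusSite x, ← FermionTorus.toTorusSite_ofTorusSite y, h]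

omit [NeZero L] in
/-- `Torus.proj L 0 = 0`. [folklore] -/
theorem torusProj_zero : Torus.proj L (0 : Site 2) = 0 := by
  funext i
  simp [Torus.proj]

/-- **Orthogonality off the 5-point neighbourhood.** On the filled lattice the vectors `P_x |univ⟩` and
`P_y |univ⟩` are orthogonal unless `x = y + e` for some `e ∈ {0, ±e₁, ±e₂}`: the basis vectors in the
support of `P_y |univ⟩` miss an orbital AT `y` and contain every orbital away from `y, y ± e`, while those in
the support of `P_x |univ⟩` miss an orbital at `x`. [folklore] -/
theorem star_localPair_full_dotProduct_eq_zero (g : Site 2 → ℝ) {x y : TorusSite 2 L}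
    (hxy : ∀ e ∈ insert (0 : Site 2) unitSteps, x ≠ y + Torus.proj L e) :
    star (localPair g L x *ᵥ Pi.single (Finset.univ : Finset (Orb (FermionTorus 2 L))) (1 : ℂ)) ⬝ᵥ
      (localPair g L y *ᵥ Pi.single (Finset.univ : Finset (Orb (FermionTorus 2 L))) (1 : ℂ)) = 0 := by
  refine Finset.sum_eq_zero fun t _ => ?_
  by_cases hy : (localPair g L y *ᵥ Pi.single (Finset.univ : Finset (Orb (FermionTorus 2 L))) (1 : ℂ)) t = 0
  · rw [hy, mul_zero]
  -- `t` lies in the support of `P_y |univ⟩`: `t = (univ ∖ {b}) ∖ {a}` with `a` at `y`, `b` at `y + e`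
  have hsupp : ∃ e ∈ insert (0 : Site 2) unitSteps, ∃ σ τ : Fin 2,
      t = (Finset.univ.erase (orb (FermionTorus.ofTorusSite (y + Torus.proj L e)) τ)).erase
        (orb (FermionTorus.ofTorusSite y) σ) := by
    by_contra hcon
    push Not at hcon
    exact hy (localPair_mulVec_full_apply_eq_zero g y fun e he => ⟨hcon e he 0 1, hcon e he 1 0⟩)
  obtain ⟨e, he, σ, τ, rfl⟩ := hsupp
  -- every orbital at `x` belongs to `t`
  have hx0 : x ≠ y := by
    have h := hxy 0 (Finset.mem_insert_self _ _)
    rwa [torusProj_zero, add_zero] at h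
  have hmem : ∀ σ' : Fin 2, orb (FermionTorus.ofTorusSite x) σ' ∈
      (Finset.univ.erase (orb (FermionTorus.ofTorusSite (y + Torus.proj L e)) τ)).erase
        (orb (FermionTorus.ofTorusSite y) σ) := by
    intro σ'
    refine Finset.mem_erase.2 ⟨fun h => hx0 (ofTorusSite_injective' (orb_eq_orb_iff.1 h).1), ?_⟩
    refine Finset.mem_erase.2 ⟨fun h => hxy e he (ofTorusSite_injective' (orb_eq_orb_iff.1 h).1),
      Finset.mem_univ _⟩
  -- hence `P_x |univ⟩` vanishes at `t`
  have hx : (localPair g L x *ᵥ Pi.single (Finset.univ : Finset (Orb (FermionTorus 2 L))) (1 : ℂ))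
      ((Finset.univ.erase (orb (FermionTorus.ofTorusSite (y + Torus.proj L e)) τ)).erase
        (orb (FermionTorus.ofTorusSite y) σ)) = 0 := by
    refine localPair_mulVec_full_apply_eq_zero g x fun e' _ => ⟨fun h => ?_, fun h => ?_⟩
    · have := hmem 0
      rw [h] at this
      exact Finset.notMem_erase _ _ this
    · have := hmem 1
      rw [h] at this
      exact Finset.notMem_erase _ _ this
  rw [Pi.star_apply, hx, star_zero, zero_mul]

omit [NeZero L] in
/-- `Re⟨a, b⟩ ≤ (‖a‖² + ‖b‖²)/2` on the Fock space (from `0 ≤ ‖a - b‖²`). [folklore] -/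
theorem re_dotProduct_le_half (a b : Fock (Orb (FermionTorus 2 L))) :
    (star a ⬝ᵥ b).re ≤ ((star a ⬝ᵥ a).re + (star b ⬝ᵥ b).re) / 2 := by
  have h0 : 0 ≤ (star (a - b) ⬝ᵥ (a - b)).re := (Complex.nonneg_iff.1 (dotProduct_star_self_nonneg _)).1
  have hexp : star (a - b) ⬝ᵥ (a - b) = star a ⬝ᵥ a - star a ⬝ᵥ b - star b ⬝ᵥ a + star b ⬝ᵥ b := by
    rw [star_sub, sub_dotProduct, dotProduct_sub, dotProduct_sub]
    ring
  have hconj : (star b ⬝ᵥ a).re = (star a ⬝ᵥ b).re := by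
    rw [star_dotProduct b a, Complex.star_def, Complex.conj_re]
  rw [hexp, Complex.add_re, Complex.sub_re, Complex.sub_re, hconj] at h0
  linarith

omit [NeZero L] in
/-- At most FIVE block offsets are one step away from a given site: for `R' ≤ L`, a site `x`, an anchor `u`,
`#{w ∈ [0,R')² : x = u + w + e for some e ∈ {0, ±e₁, ±e₂}} ≤ 5` (`w ↦ u + w` is injective below `L`).
[folklore] -/
theorem card_filter_near_le_five (R' : ℕ) (hR'L : R' ≤ L) (x u : TorusSite 2 L) :
    (Finset.univ.filter fun w : Fin 2 → Fin R' =>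
        ∃ e ∈ insert (0 : Site 2) unitSteps, x = (u + fun i => ((w i : ℕ) : ZMod L)) + Torus.proj L e).card ≤ 5 := by
  have hcard5 : (insert (0 : Site 2) unitSteps).card ≤ 5 :=
    (Finset.card_insert_le _ _).trans (Nat.succ_le_succ wib_card_unitSteps_le_four)
  refine le_trans ?_ ((Finset.card_image_le (s := insert (0 : Site 2) unitSteps)
    (f := fun e => x - Torus.proj L e)).trans hcard5)
  refine Finset.card_le_card_of_injOn (fun w => u + fun i => ((w i : ℕ) : ZMod L)) (fun w hw => ?_) ?_
  · simp only [Finset.coe_filter, Finset.mem_univ, true_and, Set.mem_setOf_eq] at hw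
    obtain ⟨e, he, hxe⟩ := hw
    simp only [Finset.coe_image, Set.mem_image, Finset.mem_coe]
    exact ⟨e, he, by rw [hxe, add_sub_cancel_right]⟩
  · intro w₁ _ w₂ _ h
    have h' : (fun i => ((w₁ i : ℕ) : ZMod L)) = fun i => ((w₂ i : ℕ) : ZMod L) := add_left_cancel h
    funext i
    have hi := congrFun h' i
    apply Fin.ext
    have h1 : (w₁ i : ℕ) < L := lt_of_lt_of_le (w₁ i).isLt hR'L
    have h2 : (w₂ i : ℕ) < L := lt_of_lt_of_le (w₂ i).isLt hR'L
    have := congrArg ZMod.val hi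
    rwa [ZMod.val_natCast_of_lt h1, ZMod.val_natCast_of_lt h2] at this

/-- **The sub-window pair weight of the filled lattice is `O(R'²)`**: for `R' ≤ L` and every anchor `u`,
`Re⟨B'_u univ, B'_u univ⟩ ≤ 160 R'²` (`B'_u = Σ_{w ∈ [0,R')²} P_{u+w}`; expand, keep the `≤ 5` neighbours of each
`x` by `star_localPair_full_dotProduct_eq_zero`, and bound each by `(‖P_x univ‖² + ‖P_y univ‖²)/2 ≤ 32`).
[folklore] -/
theorem re_star_block_full_le (R' : ℕ) (hR'L : R' ≤ L) (u : TorusSite 2 L) :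
    (star ((∑ w : Fin 2 → Fin R', localPair dWaveFormFactor L (u + fun i => ((w i : ℕ) : ZMod L))) *ᵥ
        Pi.single (Finset.univ : Finset (Orb (FermionTorus 2 L))) (1 : ℂ)) ⬝ᵥ
      ((∑ w : Fin 2 → Fin R', localPair dWaveFormFactor L (u + fun i => ((w i : ℕ) : ZMod L))) *ᵥ
        Pi.single (Finset.univ : Finset (Orb (FermionTorus 2 L))) (1 : ℂ))).re ≤ 160 * (R' : ℝ) ^ 2 := by
  set Ω : Fock (Orb (FermionTorus 2 L)) := Pi.single (Finset.univ : Finset (Orb (FermionTorus 2 L))) (1 : ℂ)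
    with hΩ
  have hΩ1 : (star Ω ⬝ᵥ Ω).re = 1 := by
    rw [hΩ, ← Pi.single_star, star_one, single_dotProduct, one_mul, Pi.single_eq_same, Complex.one_re]
  -- expand the double sum
  rw [Matrix.sum_mulVec, star_sum, sum_dotProduct, Complex.re_sum]
  have hrow : ∀ w : Fin 2 → Fin R',
      (star (localPair dWaveFormFactor L (u + fun i => ((w i : ℕ) : ZMod L)) *ᵥ Ω) ⬝ᵥ
        ∑ w' : Fin 2 → Fin R', localPair dWaveFormFactor L (u + fun i => ((w' i : ℕ) : ZMod L)) *ᵥ Ω).re ≤ 160 := by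
    intro w
    set x : TorusSite 2 L := u + fun i => ((w i : ℕ) : ZMod L) with hx
    rw [dotProduct_sum, Complex.re_sum]
    rw [← Finset.sum_filter_of_ne (p := fun w' : Fin 2 → Fin R' =>
      ∃ e ∈ insert (0 : Site 2) unitSteps, x = (u + fun i => ((w' i : ℕ) : ZMod L)) + Torus.proj L e)]
    · calc _ ≤ ∑ _w' ∈ Finset.univ.filter (fun w' : Fin 2 → Fin R' =>
              ∃ e ∈ insert (0 : Site 2) unitSteps, x = (u + fun i => ((w' i : ℕ) : ZMod L)) + Torus.proj L e),
              (32 : ℝ) := by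
            refine Finset.sum_le_sum fun w' _ => ?_
            refine (re_dotProduct_le_half _ _).trans ?_
            have h1 := wib_re_star_localPair_mulVec_le L x Ω
            have h2 := wib_re_star_localPair_mulVec_le L (u + fun i => ((w' i : ℕ) : ZMod L)) Ω
            rw [hΩ1, mul_one] at h1 h2
            linarith
        _ ≤ 160 := by
            rw [Finset.sum_const, nsmul_eq_mul]
            have h5 := card_filter_near_le_five R' hR'L x u
            have : ((Finset.univ.filter fun w' : Fin 2 → Fin R' =>
                ∃ e ∈ insert (0 : Site 2) unitSteps,
                  x = (u + fun i => ((w' i : ℕ) : ZMod L)) + Torus.proj L e).card : ℝ) ≤ 5 := by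
              exact_mod_cast h5
            linarith
    · intro w' _ hne
      by_contra hfar
      push Not at hfar
      exact hne (by rw [star_localPair_full_dotProduct_eq_zero dWaveFormFactor hfar, Complex.zero_re])
  calc _ ≤ ∑ _w : Fin 2 → Fin R', (160 : ℝ) := Finset.sum_le_sum fun w _ => hrow w
    _ = 160 * (R' : ℝ) ^ 2 := by
        rw [Finset.sum_const, Finset.card_univ, Fintype.card_fun, Fintype.card_fin, Fintype.card_fin,
          nsmul_eq_mul, Nat.cast_pow]
        ring

/-- Every local pair operator kills the vacuum. [folklore] -/
theorem localPair_mulVec_vacuum (g : Site 2 → ℝ) (x : TorusSite 2 L) :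
    localPair g L x *ᵥ (vacuum : Fock (Orb (FermionTorus 2 L))) = 0 := by
  unfold localPair
  rw [Matrix.sum_mulVec]
  refine Finset.sum_eq_zero fun e _ => ?_
  rw [smul_mulVec, sub_mulVec, ← mulVec_mulVec, ← mulVec_mulVec, annihilation_mulVec_vacuum_holds,
    annihilation_mulVec_vacuum_holds, mulVec_zero, mulVec_zero, sub_self, smul_zero]

end Full

/-! ### §2 The two extreme sectors -/

section Sectors

variable {L : ℕ} [NeZero L]

omit [NeZero L] in
/-- The vacuum is a `0`-particle vector. [folklore] -/
theorem isNParticle_vacuum' : IsNParticle 0 (vacuum : Fock (Orb (FermionTorus 2 L))) := by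
  intro s hs
  have hne : s ≠ ∅ := fun h => hs (by rw [h, Finset.card_empty])
  show (Pi.single (∅ : Finset (Orb (FermionTorus 2 L))) (1 : ℂ) : Fock (Orb (FermionTorus 2 L))) s = 0
  exact Pi.single_eq_of_ne hne _

omit [NeZero L] in
/-- The filled lattice is a `|Orb|`-particle vector. [folklore] -/
theorem isNParticle_full :
    IsNParticle (Fintype.card (Orb (FermionTorus 2 L)))
      (Pi.single (Finset.univ : Finset (Orb (FermionTorus 2 L))) (1 : ℂ)) := by
  intro s hs
  have hne : s ≠ Finset.univ := fun h => hs (by rw [h, Finset.card_univ])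
  exact Pi.single_eq_of_ne hne _

omit [NeZero L] in
/-- The `0`-particle sector is spanned by the vacuum. [folklore] -/
theorem eq_smul_vacuum_of_isNParticle_zero {φ : Fock (Orb (FermionTorus 2 L))} (h : IsNParticle 0 φ) :
    φ = φ ∅ • (vacuum : Fock (Orb (FermionTorus 2 L))) := by
  funext s
  by_cases hs : s = ∅
  · subst hs
    simp [vacuum]
  · have hcard : s.card ≠ 0 := fun h0 => hs (Finset.card_eq_zero.1 h0)
    rw [h s hcard, Pi.smul_apply, vacuum, Pi.single_eq_of_ne hs, smul_zero]

omit [NeZero L] in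
/-- The top sector is spanned by the filled lattice. [folklore] -/
theorem eq_smul_full_of_isNParticle_card {φ : Fock (Orb (FermionTorus 2 L))}
    (h : IsNParticle (Fintype.card (Orb (FermionTorus 2 L))) φ) :
    φ = φ Finset.univ • Pi.single (Finset.univ : Finset (Orb (FermionTorus 2 L))) (1 : ℂ) := by
  funext s
  by_cases hs : s = Finset.univ
  · subst hs
    simp
  · have hcard : s.card ≠ Fintype.card (Orb (FermionTorus 2 L)) := fun h0 => hs ((Finset.card_eq_iff_eq_univ s).1 h0)
    rw [h s hcard, Pi.smul_apply, Pi.single_eq_of_ne hs, smul_zero]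

omit [NeZero L] in
/-- `[H_L, N̂] = 0` for the Hubbard torus. [folklore] -/
theorem hubbardTorus_commute_totalNumberOp (U : ℝ) :
    Commute (hubbardTorus 2 L 1 U) (totalNumberOp : Matrix (Finset (Orb (FermionTorus 2 L))) _ ℂ) := by
  rw [totalNumberOp_eq_totalNumber]
  exact ((hamiltonian_isHermitian_and_commute_holds (fermionTorusGraph 2 L)) 1 U).2.1

omit [NeZero L] in
/-- A common eigenvector of `H` and `Q` is killed by `HQ - QH`. [folklore] -/
theorem comm_mulVec_eq_zero_of_eigen {H Q : Matrix (Finset (Orb (FermionTorus 2 L))) (Finset (Orb (FermionTorus 2 L))) ℂ}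
    {φ : Fock (Orb (FermionTorus 2 L))} {c E : ℂ} (hQ : Q *ᵥ φ = c • φ) (hH : H *ᵥ φ = E • φ) :
    (H * Q - Q * H) *ᵥ φ = 0 := by
  rw [sub_mulVec, ← mulVec_mulVec, ← mulVec_mulVec, hQ, hH, mulVec_smul, mulVec_smul, hH, hQ, smul_smul,
    smul_smul, mul_comm, sub_self]

/-- Every orbital of the filled lattice is occupied: `n_{xσ} |univ⟩ = |univ⟩`. [folklore] -/
theorem numberOp_mulVec_full (x : TorusSite 2 L) (σ : Fin 2) :
    numberOp (FermionTorus.ofTorusSite x) σ *ᵥ Pi.single (Finset.univ : Finset (Orb (FermionTorus 2 L))) (1 : ℂ) =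
      Pi.single (Finset.univ : Finset (Orb (FermionTorus 2 L))) (1 : ℂ) := by
  unfold numberOp
  rw [← mulVec_mulVec, annihilation_mulVec_single, if_pos (Finset.mem_univ _), mulVec_smul,
    FermionOperatorsProofs.creation_mulVec_single, if_neg (Finset.notMem_erase _ _),
    Finset.insert_erase (Finset.mem_univ _), smul_smul, jwSign_erase_of_not_lt (lt_irrefl _), jwSign_mul_self,
    one_smul]

/-- Expectations in the filled lattice are translation invariant (`T_u |univ⟩ = ±|univ⟩`). [folklore] -/
theorem expect_relabel_translate_full (u : TorusSite 2 L)
    (A : Matrix (Finset (Orb (FermionTorus 2 L))) (Finset (Orb (FermionTorus 2 L))) ℂ) :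
    star (Pi.single (Finset.univ : Finset (Orb (FermionTorus 2 L))) (1 : ℂ)) ⬝ᵥ relabel (Orb.translate u) A *ᵥ
        Pi.single (Finset.univ : Finset (Orb (FermionTorus 2 L))) (1 : ℂ) =
      star (Pi.single (Finset.univ : Finset (Orb (FermionTorus 2 L))) (1 : ℂ)) ⬝ᵥ A *ᵥ
        Pi.single (Finset.univ : Finset (Orb (FermionTorus 2 L))) (1 : ℂ) := by
  have h := expect_relabel_fockRelabel_mulVec (Orb.translate u) A
    (Pi.single (Finset.univ : Finset (Orb (FermionTorus 2 L))) (1 : ℂ))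
  rw [fockRelabel_mulVec_single, Finset.map_univ_equiv, Literature.MathematicalPhysics.QuantumLattice.expect,
    Literature.MathematicalPhysics.QuantumLattice.expect, mulVec_smul, star_smul, smul_dotProduct, dotProduct_smul,
    smul_smul, star_relabelSign, relabelSign_mul_self, one_smul] at h
  exact h

omit [NeZero L] in
/-- Expectations in the vacuum are translation invariant (`T_u |∅⟩ = |∅⟩`). [folklore] -/
theorem expect_relabel_translate_vacuum [NeZero L] (u : TorusSite 2 L)
    (A : Matrix (Finset (Orb (FermionTorus 2 L))) (Finset (Orb (FermionTorus 2 L))) ℂ) :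
    star (vacuum : Fock (Orb (FermionTorus 2 L))) ⬝ᵥ relabel (Orb.translate u) A *ᵥ vacuum =
      star (vacuum : Fock (Orb (FermionTorus 2 L))) ⬝ᵥ A *ᵥ vacuum := by
  have h := expect_relabel_fockRelabel_mulVec (Orb.translate u) A (vacuum : Fock (Orb (FermionTorus 2 L)))
  rw [fockRelabel_mulVec_vacuum] at h
  exact h

end Sectors

/-- **Registered form of the filled-lattice block bound** (sub-goal `fullLatticeBlockBound` of crux
stmt-HubbardSuperconductivity-7331, line `Sketch`; verbatim `re_star_block_full_le`). [folklore] -/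
theorem fullLatticeBlockBound : ∀ {L : ℕ} [NeZero L] (R' : ℕ), R' ≤ L → ∀ u : TorusSite 2 L, (star ((∑ w : Fin 2 → Fin R', localPair dWaveFormFactor L (u + fun i => ((w i : ℕ) : ZMod L))) *ᵥ Pi.single (Finset.univ : Finset (Orb (FermionTorus 2 L))) (1 : ℂ)) ⬝ᵥ ((∑ w : Fin 2 → Fin R', localPair dWaveFormFactor L (u + fun i => ((w i : ℕ) : ZMod L))) *ᵥ Pi.single (Finset.univ : Finset (Orb (FermionTorus 2 L))) (1 : ℂ))).re ≤ 160 * (R' : ℝ) ^ 2 :=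
  fun R' hR'L u => re_star_block_full_le R' hR'L u

end Summit.HubbardSuperconductivity.HubbardSuperconductivity.Theorems.FunctionFieldCertificate
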